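import Summits.QuantumFields.YangMills.Theorems.UnitScaleTiltProp7QTwSRealityOfRegPr
import Summits.QuantumFields.YangMills.Theorems.UnitScaleTiltProp7QTwSReality
import Summits.QuantumFields.YangMills.Theorems.UnitScaleTiltProp7QkOntoOfRegPr
import Mathlib.Analysis.Calculus.InverseFunctionTheorem.FDeriv
import HarnessLib

/-!
# Route `UnitScaleTilt`, crux K1 child «MinimiserStabilityRegPr» (stmt-QuantumFields-19200), skeleton v10, stub `stub_existenceMinimalOrbit` (EX), route (α),
# DENSITY line (★★OWNER RULING g28-№8 (B)) — **(D4a) THE RE-BASED TWISTED CHART IS LOCALLY ONTO THE REAL COARSE DATA AT A PRINTED-REGULAR BACKGROUND: for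
# `U₀ ∈ 𝔘_k(ε₀)` (`13·10¹⁴L³ε₀ ≤ 1`, `n < K`) and every neighbourhood `N` of `0` among the fine bond fields there is a neighbourhood `W` of `0` among the coarse
# bond fields such that every `𝔰𝔲(2)`-valued `w ∈ W` is `log U̿^{twS}(A)` for some `𝔰𝔲(2)`-valued `A ∈ N`** — the inverse function theorem (Mathlib
# `HasStrictFDerivAt.map_nhds_eq_of_surj`) applied OVER `ℝ` to `(X, Y) ↦ π(log U̿^{twS}(πX)) + (Y − πY)` (`π` = the `𝔰𝔲(2)`-part projections), whose derivative at `0` is onto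
# because print's `Q(U₀) = QTwS U₀` maps the `𝔰𝔲(2)`-valued fine fields ONTO the `𝔰𝔲(2)`-valued block fields (complex onto ✓`surjective_QTwS_of_regPr` + the three reality
# sectors ✓`QTwS_star_comm_of_regPr` ∕ ✓`QTwS_scalar_of_regPr` ∕ ✓`QTwS_traceless_of_regPr`), and whose values on small `𝔰𝔲(2)`-valued `A` ARE `𝔰𝔲(2)`-valued
# (✓`logChartTwS_skewHermitian_of_ball` ∘ ✓`dbarTwS_mem_specialUnitaryUnits_of_skewHermitian`).

Cell `ym3-torus`, width seat `ym3-torus-px10` (gen 3).  THEOREMS ONLY (0 `def`, 0 `sorry`).  `--supports stmt-QuantumFields-19200 --as helper`,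
count-neutral.  YM₃ on T³ is a ladder rung (R3), not the Clay problem; nothing here claims the stub, the crux, d = 4 or the mass gap.

WHY.  First half of the DENSITY line's row (D4) «the descent `D_{n,K}` is locally onto at printed-regular points» (hypothesis `hLS` of ✓p674041
`Prop7ExistenceByDensityLimit.existenceMinimalOrbit_of_macroSector_dense_localSurj`); the second half (sibling `…DescentLocallyOntoOfRegPr`) reads `log U̿^{twS}(A) = w` as
«`e^{A}U₀`, regauged by the symmetric frames, lies in the fibre of `e^{w}·V`».

WHAT IS PROVED (sorry-free, no definition; ns `…Theorems.Prop7TwistedChartLocallyOnto`):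
* §1 `exists_su2_preimage_QTwS_of_regPr` — REAL ONTO-NESS of `Q(U₀)`: every `𝔰𝔲(2)`-valued block field is `QTwS U₀ A` with `A` `𝔰𝔲(2)`-valued (`A := ` the traceless part of the
  skew-Hermitian part of a complex preimage).
* §2 the `𝔰𝔲(2)`-part projection, INLINE as an `ℝ`-linear map built in the proofs (no `def`): `M ↦ ½(M − Mᴴ) − ¼·tr(M − Mᴴ)·1` is `𝔰𝔲(2)`-valued and the identity on `𝔰𝔲(2)`.
* §3 ★★★ `exists_logChartTwS_eq_of_nhds` — the local onto-ness statement of the title.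

HONEST SCOPE.  Calculus and linear algebra over the tree's own chart letters; nothing of [Balaban1985Variational] is asserted; no stub ∕ crux statement is advanced; YM₃ on T³ =
rung R3 — not d = 4, not infinite volume, not a mass gap, not Clay.

References: T. Bałaban, CMP 99 (1985) 389–434 [Balaban1985BackgroundPropagators] ((3.13)–(3.15) p.393, (3.19) p.393); CMP 102 (1985) 277–309 [Balaban1985Variational] ((44)–(51)
pp.285–286, Prop. 3 p.289); CMP 98 (1985) 17–51 [Balaban1985Averaging] ((89)–(92) p.31).
-/

set_option autoImplicit false

noncomputable section

open Metric Set Filter Topology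
open scoped Matrix.Norms.L2Operator

namespace Summit.QuantumFields.YangMills.Theorems.Prop7TwistedChartLocallyOnto

open Literature.MathematicalPhysics.QuantumFieldTheory.Balaban1983to89
open Literature.MathematicalPhysics.QuantumFieldTheory.Balaban1983to89.T3ContinuumYM3Torus
open T3PrintedRegularMinimiser (RegPr)
open T3SectALandauChart (eta eta_pos pos_of_regPr)
open Summit.QuantumFields.YangMills.Theorems.Prop7SymAvgTwSym (logChartTwS QTwS logChartTwS_zero QTwS_def QTwS_star_comm_of_regPr QTwS_scalar_of_regPr
  QTwS_traceless_of_regPr)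
open Summit.QuantumFields.YangMills.Theorems.Prop7ChartRealityTwS (logChartTwS_skewHermitian_of_ball dbarTwS_mem_specialUnitaryUnits_of_skewHermitian)
open Summit.QuantumFields.YangMills.Theorems.Prop7CmapTwSymInputs (analyticOnNhd_logChartTwS)
open Summit.QuantumFields.YangMills.Theorems.Prop7QkOntoOfRegPr (surjective_QTwS_of_regPr)

variable (F : T3Family) {n K : ℕ} (h : n ≤ K)

/-! ## §1 Real onto-ness of `Q(U₀)` on the `𝔰𝔲(2)`-valued fields -/

/-- The trace of a skew-Hermitian `2 × 2` matrix is purely imaginary: `star (tr M) = −tr M`. [folklore] -/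
theorem star_trace_of_skewHermitian {M : Matrix (Fin 2) (Fin 2) ℂ} (hM : star M = -M) : star M.trace = -M.trace := by
  rw [← Matrix.trace_conjTranspose, ← Matrix.star_eq_conjTranspose, hM, Matrix.trace_neg]

/-- `star` of a rational numeral of `ℂ`. [folklore] -/
theorem star_ofNat_div (a b : ℕ) : star ((a : ℂ) / (b : ℂ)) = (a : ℂ) / (b : ℂ) := by
  rw [Complex.star_def, map_div₀, Complex.conj_natCast, Complex.conj_natCast]

/-- **REAL ONTO-NESS OF PRINT'S `Q(U₀)`**: at `U₀ ∈ 𝔘_k(ε₀)` (`13·10¹⁴L³ε₀ ≤ 1`, `n < K`) every `𝔰𝔲(2)`-valued block field `w` is `QTwS U₀ A` for an `𝔰𝔲(2)`-valued fine field `A`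
(complex onto-ness ✓`surjective_QTwS_of_regPr`; `A :=` the traceless part of the skew-Hermitian part of a complex preimage, using the three reality sectors of `QTwS U₀`).
[cite: Balaban1985BackgroundPropagators, (3.19) p.393, (3.13)-(3.14) p.393; Balaban1985Variational, (51) p.286] -/
theorem exists_su2_preimage_QTwS_of_regPr (hnK : n < K) {ε₀ : ℝ} {U₀ : GaugeField (F.P K) 0 (Matrix.specialUnitaryGroup (Fin 2) ℂ)} (hreg : RegPr F n K ε₀ U₀)
    (hwin : 13 * 10 ^ 14 * (F.L : ℝ) ^ 3 * ε₀ ≤ 1) (w : PBond (F.P n) 0 → Matrix (Fin 2) (Fin 2) ℂ) (hw : ∀ c, star (w c) = -w c ∧ (w c).trace = 0) :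
    ∃ A : PBond (F.P K) 0 → Matrix (Fin 2) (Fin 2) ℂ, (∀ b, star (A b) = -A b ∧ (A b).trace = 0) ∧ QTwS F n K h U₀ A = w := by
  haveI : Fact (0 < (F.L : ℝ)) := ⟨by have := F.hL.2; exact_mod_cast (by omega : 0 < F.L)⟩
  haveI : Fact (0 < ((F.L : ℝ)⁻¹) ^ (K - n)) := ⟨by have : (0 : ℝ) < F.L := Fact.out; positivity⟩
  have hε₀ : 0 < ε₀ := pos_of_regPr F hreg
  have hL1 : (1 : ℝ) ≤ F.L := by have := F.hL.2; exact_mod_cast (by omega : 1 ≤ F.L)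
  have hL3 : (1 : ℝ) ≤ (F.L : ℝ) ^ 3 := one_le_pow₀ hL1
  have hx : 0 ≤ (F.L : ℝ) ^ 3 * ε₀ := by positivity
  have hWε : 10 ^ 12 * (F.L : ℝ) ^ 3 * ε₀ ≤ 1 := by nlinarith
  -- the window `10⁹L²e ≤ 1` is inhabited
  have he : (0 : ℝ) < 1 / (10 ^ 9 * (F.L : ℝ) ^ 2) := by positivity
  have hWe : 10 ^ 9 * (F.L : ℝ) ^ 2 * (1 / (10 ^ 9 * (F.L : ℝ) ^ 2)) ≤ 1 := by rw [mul_one_div_cancel (by positivity)]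
  have hstar := QTwS_star_comm_of_regPr F h hε₀ he hWe hWε U₀ hreg
  have htr := QTwS_traceless_of_regPr F h hε₀ he hWe hWε U₀ hreg
  have h12 : star ((1 : ℂ) / 2) = 1 / 2 := by have := star_ofNat_div 1 2; push_cast at this; exact this
  -- a complex preimage, its skew-Hermitian part, and the traceless part of that
  obtain ⟨Z, hZ⟩ := surjective_QTwS_of_regPr F h hnK hreg hwin w
  set A₁ : PBond (F.P K) 0 → Matrix (Fin 2) (Fin 2) ℂ := fun b => ((1 : ℂ) / 2) • (Z b - star (Z b)) with hA₁
  have hA₁s : ∀ b, star (A₁ b) = -A₁ b := fun b => by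
    simp only [hA₁, star_smul, star_sub, star_star, h12, ← smul_neg, neg_sub]
  have hA₁lin : A₁ = ((1 : ℂ) / 2) • (Z - star Z) := by funext b; simp [hA₁]
  have hQA₁ : QTwS F n K h U₀ A₁ = w := by
    rw [hA₁lin, map_smul, map_sub, hstar Z, hZ]
    funext c
    rw [Pi.smul_apply, Pi.sub_apply, Pi.star_apply, (hw c).1, sub_neg_eq_add, ← two_smul ℂ (w c), smul_smul]
    norm_num
  set s : PBond (F.P K) 0 → ℂ := fun b => ((1 : ℂ) / 2) * (A₁ b).trace with hs
  set A : PBond (F.P K) 0 → Matrix (Fin 2) (Fin 2) ℂ := fun b => A₁ b - s b • (1 : Matrix (Fin 2) (Fin 2) ℂ) with hA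
  have hss : ∀ b, star (s b) = -s b := fun b => by
    simp only [hs, star_mul, star_trace_of_skewHermitian (hA₁s b), h12]
    ring
  have hAsu : ∀ b, star (A b) = -A b ∧ (A b).trace = 0 := fun b => by
    refine ⟨?_, ?_⟩
    · simp only [hA, star_sub, star_smul, star_one, hA₁s b, hss b, neg_smul, neg_sub]
      abel
    · simp only [hA, Matrix.trace_sub, Matrix.trace_smul, Matrix.trace_one, Fintype.card_fin, hs, smul_eq_mul]
      push_cast
      ring
  -- the scalar sector: `QTwS (s·1) = d·1` with `d` traceless against `tr`, hence `0`
  obtain ⟨d, hd⟩ := QTwS_scalar_of_regPr F h hε₀ hWε U₀ hreg s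
  have hAlin : A = A₁ - fun b => s b • (1 : Matrix (Fin 2) (Fin 2) ℂ) := by funext b; simp [hA]
  have hQA : QTwS F n K h U₀ A = w - fun c => d c • (1 : Matrix (Fin 2) (Fin 2) ℂ) := by
    rw [hAlin, map_sub, hQA₁, hd]
  have hd0 : ∀ c, d c = 0 := fun c => by
    have h1 := htr A (fun b => (hAsu b).2) c
    rw [hQA, Pi.sub_apply, Matrix.trace_sub, (hw c).2, Matrix.trace_smul, Matrix.trace_one, Fintype.card_fin, zero_sub, neg_eq_zero,
      smul_eq_mul] at h1
    have h2 : d c * 2 = 0 := by exact_mod_cast h1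
    simpa using h2
  refine ⟨A, hAsu, ?_⟩
  rw [hQA]
  funext c
  simp [hd0 c]

/-! ## §2 The `𝔰𝔲(2)`-part projection as an `ℝ`-linear continuous map (existence, no `def`) -/

/-- The map `M ↦ ½(M − Mᴴ) − ¼·tr(M − Mᴴ)·1` is `𝔰𝔲(2)`-valued. [folklore] -/
theorem su2Part_mem (M : Matrix (Fin 2) (Fin 2) ℂ) :
    star (((1 : ℂ) / 2) • (M - star M) - (((1 : ℂ) / 4) * (M - star M).trace) • (1 : Matrix (Fin 2) (Fin 2) ℂ)) =
        -(((1 : ℂ) / 2) • (M - star M) - (((1 : ℂ) / 4) * (M - star M).trace) • (1 : Matrix (Fin 2) (Fin 2) ℂ)) ∧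
      (((1 : ℂ) / 2) • (M - star M) - (((1 : ℂ) / 4) * (M - star M).trace) • (1 : Matrix (Fin 2) (Fin 2) ℂ)).trace = 0 := by
  have hD : star (M - star M) = -(M - star M) := by rw [star_sub, star_star, neg_sub]
  have ht : star (M - star M).trace = -(M - star M).trace := star_trace_of_skewHermitian hD
  have h12 : star ((1 : ℂ) / 2) = 1 / 2 := by have := star_ofNat_div 1 2; push_cast at this; exact this
  have h14 : star ((1 : ℂ) / 4) = 1 / 4 := by have := star_ofNat_div 1 4; push_cast at this; exact this
  refine ⟨?_, ?_⟩
  · rw [star_sub, star_smul, star_smul, star_one, hD, star_mul, ht, h12, h14, smul_neg,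
      show -(M - star M).trace * (1 / 4) = -((1 / 4 : ℂ) * (M - star M).trace) by ring, neg_smul]
    abel
  · rw [Matrix.trace_sub, Matrix.trace_smul, Matrix.trace_smul, Matrix.trace_one, Fintype.card_fin, smul_eq_mul, smul_eq_mul]
    push_cast
    ring

/-- The same map is the identity on `𝔰𝔲(2)`. [folklore] -/
theorem su2Part_of_mem {M : Matrix (Fin 2) (Fin 2) ℂ} (hM : star M = -M ∧ M.trace = 0) :
    ((1 : ℂ) / 2) • (M - star M) - (((1 : ℂ) / 4) * (M - star M).trace) • (1 : Matrix (Fin 2) (Fin 2) ℂ) = M := by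
  rw [hM.1, sub_neg_eq_add, Matrix.trace_add, hM.2, add_zero, mul_zero, zero_smul, sub_zero, ← two_smul ℂ M, smul_smul]
  norm_num

/-- **THE `𝔰𝔲(2)`-PART PROJECTION ON BOND FIELDS AS AN `ℝ`-LINEAR CONTINUOUS MAP** (existence; the formula bondwise; `𝔰𝔲(2)`-valued; the identity on `𝔰𝔲(2)`-valued
fields). [folklore] -/
theorem exists_su2Proj (ι : Type) [Fintype ι] :
    ∃ π : (ι → Matrix (Fin 2) (Fin 2) ℂ) →L[ℝ] (ι → Matrix (Fin 2) (Fin 2) ℂ),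
      (∀ X b, π X b = ((1 : ℂ) / 2) • (X b - star (X b)) - (((1 : ℂ) / 4) * (X b - star (X b)).trace) • (1 : Matrix (Fin 2) (Fin 2) ℂ)) ∧
      (∀ X b, star (π X b) = -π X b ∧ (π X b).trace = 0) ∧
      (∀ X, (∀ b, star (X b) = -X b ∧ (X b).trace = 0) → π X = X) ∧ (∀ X, π (π X) = π X) := by
  let p : (ι → Matrix (Fin 2) (Fin 2) ℂ) →ₗ[ℝ] (ι → Matrix (Fin 2) (Fin 2) ℂ) :=
    { toFun := fun X b => ((1 : ℂ) / 2) • (X b - star (X b)) - (((1 : ℂ) / 4) * (X b - star (X b)).trace) • (1 : Matrix (Fin 2) (Fin 2) ℂ)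
      map_add' := fun X Y => by
        funext b
        simp only [Pi.add_apply, star_add, Matrix.trace_add, Matrix.trace_sub]
        rw [show X b + Y b - (star (X b) + star (Y b)) = (X b - star (X b)) + (Y b - star (Y b)) by abel, smul_add,
          show ((1 : ℂ) / 4) * ((X b).trace + (Y b).trace - ((star (X b)).trace + (star (Y b)).trace)) =
            ((1 : ℂ) / 4) * ((X b).trace - (star (X b)).trace) + ((1 : ℂ) / 4) * ((Y b).trace - (star (Y b)).trace) by ring, add_smul]
        abel
      map_smul' := fun r X => by
        funext b
        simp only [Pi.smul_apply, RingHom.id_apply]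
        rw [← Complex.coe_smul, ← Complex.coe_smul, star_smul, Complex.star_def, Complex.conj_ofReal, ← smul_sub, Matrix.trace_smul,
          smul_eq_mul, smul_smul]
        conv_rhs => rw [smul_sub, smul_smul, smul_smul]
        rw [mul_comm ((1 : ℂ) / 2) (r : ℂ), show (1 : ℂ) / 4 * ((r : ℂ) * (X b - star (X b)).trace) = (r : ℂ) * ((1 : ℂ) / 4 * (X b - star (X b)).trace) by ring] }
  refine ⟨LinearMap.toContinuousLinearMap p, fun X b => rfl, fun X b => su2Part_mem (X b), fun X hX => ?_, fun X => ?_⟩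
  · funext b; exact su2Part_of_mem (hX b)
  · funext b; exact su2Part_of_mem (su2Part_mem (X b))

/-! ## §3 ★★★ The twisted chart is locally onto the `𝔰𝔲(2)`-valued block fields -/

/-- ★★★ **THE RE-BASED TWISTED CHART IS LOCALLY ONTO THE `𝔰𝔲(2)`-VALUED BLOCK FIELDS** at `U₀ ∈ 𝔘_k(ε₀)`, `13·10¹⁴L³ε₀ ≤ 1`, `n < K`: for every neighbourhood `N` of `0`
in the fine bond fields there is a neighbourhood `W` of `0` in the block bond fields such that every `𝔰𝔲(2)`-valued `w ∈ W` is `logChartTwS U₀ A` for some `𝔰𝔲(2)`-valued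
`A ∈ N` (inverse function theorem over `ℝ` for `(X, Y) ↦ π(logChartTwS U₀ (πX)) + (Y − πY)`, `π` the `𝔰𝔲(2)`-part projection; its derivative at `0` is onto by §1; reality of
the chart on the ball `‖A‖ < e·η` by ✓`logChartTwS_skewHermitian_of_ball`).
[cite: Balaban1985BackgroundPropagators, (3.13)-(3.15) p.393, (3.19) p.393; Balaban1985Variational, (44)-(51) pp.285-286] -/
theorem exists_logChartTwS_eq_of_nhds (hnK : n < K) {ε₀ : ℝ} {U₀ : GaugeField (F.P K) 0 (Matrix.specialUnitaryGroup (Fin 2) ℂ)} (hreg : RegPr F n K ε₀ U₀)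
    (hwin : 13 * 10 ^ 14 * (F.L : ℝ) ^ 3 * ε₀ ≤ 1) :
    ∀ N ∈ 𝓝 (0 : PBond (F.P K) 0 → Matrix (Fin 2) (Fin 2) ℂ), ∃ W ∈ 𝓝 (0 : PBond (F.P n) 0 → Matrix (Fin 2) (Fin 2) ℂ),
      ∀ w ∈ W, (∀ c, star (w c) = -w c ∧ (w c).trace = 0) →
        ∃ A ∈ N, (∀ b, star (A b) = -A b ∧ (A b).trace = 0) ∧ logChartTwS F n K h U₀ A = w := by
  haveI : Fact (0 < (F.L : ℝ)) := ⟨by have := F.hL.2; exact_mod_cast (by omega : 0 < F.L)⟩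
  haveI : Fact (0 < ((F.L : ℝ)⁻¹) ^ (K - n)) := ⟨by have : (0 : ℝ) < F.L := Fact.out; positivity⟩
  have hε₀ : 0 < ε₀ := pos_of_regPr F hreg
  have hL1 : (1 : ℝ) ≤ F.L := by have := F.hL.2; exact_mod_cast (by omega : 1 ≤ F.L)
  have hL3 : (1 : ℝ) ≤ (F.L : ℝ) ^ 3 := one_le_pow₀ hL1
  have hx : 0 ≤ (F.L : ℝ) ^ 3 * ε₀ := by positivity
  have hWε : 10 ^ 12 * (F.L : ℝ) ^ 3 * ε₀ ≤ 1 := by nlinarith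
  set e : ℝ := 1 / (10 ^ 9 * (F.L : ℝ) ^ 2) with he_def
  have he : 0 < e := by positivity
  have hWe : 10 ^ 9 * (F.L : ℝ) ^ 2 * e ≤ 1 := by rw [he_def, mul_one_div_cancel (by positivity)]
  have hρ : 0 < e * eta F n K := mul_pos he (eta_pos F n K)
  haveI : CompleteSpace (PBond (F.P K) 0 → Matrix (Fin 2) (Fin 2) ℂ) := FiniteDimensional.complete ℂ _
  haveI : CompleteSpace (PBond (F.P n) 0 → Matrix (Fin 2) (Fin 2) ℂ) := FiniteDimensional.complete ℂ _
  -- the `𝔰𝔲(2)`-part projections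
  obtain ⟨πS, -, hπS_mem, hπS_id, -⟩ := exists_su2Proj (PBond (F.P K) 0)
  obtain ⟨πT, -, hπT_mem, hπT_id, hπT_idem⟩ := exists_su2Proj (PBond (F.P n) 0)
  -- the chart and its strict derivative at `0` over `ℝ`
  have han : AnalyticAt ℂ (logChartTwS F n K h U₀) 0 :=
    (analyticOnNhd_logChartTwS F h hε₀ he hWe hWε U₀ hreg) 0 (mem_ball_self hρ)
  have hstrict : HasStrictFDerivAt (logChartTwS F n K h U₀) ((QTwS F n K h U₀).restrictScalars ℝ) 0 := by
    have h1 := han.hasStrictFDerivAt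
    rw [← QTwS_def] at h1
    exact h1.restrictScalars ℝ
  -- `f (X, Y) := πT (logChartTwS (πS X)) + (Y − πT Y)` and its derivative
  have hg : HasStrictFDerivAt (fun X : PBond (F.P K) 0 → Matrix (Fin 2) (Fin 2) ℂ => πT (logChartTwS F n K h U₀ (πS X)))
      (πT.comp (((QTwS F n K h U₀).restrictScalars ℝ).comp πS)) 0 := by
    have h2 : HasStrictFDerivAt (fun X : PBond (F.P K) 0 → Matrix (Fin 2) (Fin 2) ℂ => logChartTwS F n K h U₀ (πS X))
        ((((QTwS F n K h U₀).restrictScalars ℝ)).comp πS) 0 := by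
      have h0 : πS 0 = 0 := map_zero πS
      have h3 := hstrict
      rw [← h0] at h3
      exact h3.comp 0 πS.hasStrictFDerivAt
    exact πT.hasStrictFDerivAt.comp 0 h2
  set f : (PBond (F.P K) 0 → Matrix (Fin 2) (Fin 2) ℂ) × (PBond (F.P n) 0 → Matrix (Fin 2) (Fin 2) ℂ) → (PBond (F.P n) 0 → Matrix (Fin 2) (Fin 2) ℂ) :=
    fun p => πT (logChartTwS F n K h U₀ (πS p.1)) + (p.2 - πT p.2) with hf_def
  set f' : (PBond (F.P K) 0 → Matrix (Fin 2) (Fin 2) ℂ) × (PBond (F.P n) 0 → Matrix (Fin 2) (Fin 2) ℂ) →L[ℝ] (PBond (F.P n) 0 → Matrix (Fin 2) (Fin 2) ℂ) :=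
    (πT.comp (((QTwS F n K h U₀).restrictScalars ℝ).comp πS)).comp (ContinuousLinearMap.fst ℝ _ _) +
      ((ContinuousLinearMap.id ℝ _) - πT).comp (ContinuousLinearMap.snd ℝ _ _) with hf'_def
  have hf : HasStrictFDerivAt f f' (0, 0) := by
    have hg' : HasStrictFDerivAt (fun X : PBond (F.P K) 0 → Matrix (Fin 2) (Fin 2) ℂ => πT (logChartTwS F n K h U₀ (πS X)))
        (πT.comp (((QTwS F n K h U₀).restrictScalars ℝ).comp πS))
        (Prod.fst ((0 : PBond (F.P K) 0 → Matrix (Fin 2) (Fin 2) ℂ), (0 : PBond (F.P n) 0 → Matrix (Fin 2) (Fin 2) ℂ))) := hg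
    have h1 := hg'.comp ((0 : PBond (F.P K) 0 → Matrix (Fin 2) (Fin 2) ℂ), (0 : PBond (F.P n) 0 → Matrix (Fin 2) (Fin 2) ℂ)) hasStrictFDerivAt_fst
    have h2 := (((ContinuousLinearMap.id ℝ (PBond (F.P n) 0 → Matrix (Fin 2) (Fin 2) ℂ)) - πT).comp
      (ContinuousLinearMap.snd ℝ (PBond (F.P K) 0 → Matrix (Fin 2) (Fin 2) ℂ) (PBond (F.P n) 0 → Matrix (Fin 2) (Fin 2) ℂ))).hasStrictFDerivAt
      (x := ((0 : PBond (F.P K) 0 → Matrix (Fin 2) (Fin 2) ℂ), (0 : PBond (F.P n) 0 → Matrix (Fin 2) (Fin 2) ℂ)))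
    exact h1.add h2
  -- the derivative is onto (§1)
  have hsurj : Function.Surjective f' := by
    intro z
    obtain ⟨A, hAsu, hQA⟩ := exists_su2_preimage_QTwS_of_regPr F h hnK hreg hwin (πT z) (hπT_mem z)
    refine ⟨(A, z), ?_⟩
    show πT (((QTwS F n K h U₀).restrictScalars ℝ) (πS A)) + (z - πT z) = z
    rw [hπS_id A hAsu, ContinuousLinearMap.coe_restrictScalars', hQA, hπT_idem, add_sub_cancel]
  -- the inverse function theorem: `f` maps neighbourhoods of `0` onto neighbourhoods of `f 0 = 0`
  have hf0 : f (0, 0) = 0 := by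
    show πT (logChartTwS F n K h U₀ (πS 0)) + (0 - πT 0) = 0
    simp only [map_zero, logChartTwS_zero, sub_zero, add_zero]
  have hmap : map f (𝓝 (0, 0)) = 𝓝 (f (0, 0)) := hf.map_nhds_eq_of_surj (LinearMap.range_eq_top.mpr hsurj)
  rw [hf0] at hmap
  -- extraction
  intro N hN
  have hNball : N ∩ ball (0 : PBond (F.P K) 0 → Matrix (Fin 2) (Fin 2) ℂ) (e * eta F n K) ∈ 𝓝 (0 : PBond (F.P K) 0 → Matrix (Fin 2) (Fin 2) ℂ) :=
    inter_mem hN (ball_mem_nhds _ hρ)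
  have hpre : πS ⁻¹' (N ∩ ball (0 : PBond (F.P K) 0 → Matrix (Fin 2) (Fin 2) ℂ) (e * eta F n K)) ∈ 𝓝 (0 : PBond (F.P K) 0 → Matrix (Fin 2) (Fin 2) ℂ) := by
    apply πS.continuous.continuousAt.preimage_mem_nhds
    rw [map_zero]; exact hNball
  have hprod : (πS ⁻¹' (N ∩ ball (0 : PBond (F.P K) 0 → Matrix (Fin 2) (Fin 2) ℂ) (e * eta F n K))) ×ˢ (univ : Set (PBond (F.P n) 0 → Matrix (Fin 2) (Fin 2) ℂ)) ∈
      𝓝 ((0 : PBond (F.P K) 0 → Matrix (Fin 2) (Fin 2) ℂ), (0 : PBond (F.P n) 0 → Matrix (Fin 2) (Fin 2) ℂ)) := by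
    rw [nhds_prod_eq]; exact prod_mem_prod hpre univ_mem
  refine ⟨f '' ((πS ⁻¹' (N ∩ ball (0 : PBond (F.P K) 0 → Matrix (Fin 2) (Fin 2) ℂ) (e * eta F n K))) ×ˢ (univ : Set (PBond (F.P n) 0 → Matrix (Fin 2) (Fin 2) ℂ))),
    by rw [← hmap]; exact image_mem_map hprod, ?_⟩
  rintro w ⟨⟨X, Y⟩, ⟨hX, -⟩, hXY⟩ hw
  obtain ⟨hXN, hXball⟩ := hX
  refine ⟨πS X, hXN, hπS_mem X, ?_⟩
  -- reality on the ball: `logChartTwS (πS X)` is `𝔰𝔲(2)`-valued, so `πT` fixes it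
  have hAe : ∀ b, ‖πS X b‖ ≤ e * eta F n K := fun b => (norm_le_pi_norm (πS X) b).trans (mem_ball_zero_iff.1 hXball).le
  have hreal : ∀ c, star (logChartTwS F n K h U₀ (πS X) c) = -logChartTwS F n K h U₀ (πS X) c ∧ (logChartTwS F n K h U₀ (πS X) c).trace = 0 :=
    fun c => logChartTwS_skewHermitian_of_ball F h hε₀ he.le hWe hWε U₀ hreg (πS X) hAe
      (fun c' => dbarTwS_mem_specialUnitaryUnits_of_skewHermitian F h hε₀ he.le hWe hWε U₀ hreg (πS X) (hπS_mem X) hAe c') c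
  have key : πT (f (X, Y)) = πT w := by rw [hXY]
  have hfXY : f (X, Y) = πT (logChartTwS F n K h U₀ (πS X)) + (Y - πT Y) := rfl
  rw [hfXY, map_add, map_sub, hπT_idem, hπT_idem, sub_self, add_zero, hπT_id _ hreal, hπT_id w hw] at key
  exact key

end Summit.QuantumFields.YangMills.Theorems.Prop7TwistedChartLocallyOnto

end
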